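import Mathlib
import Summits.Ventures.PercRepro2.Defs
import Summits.Ventures.PercRepro2.Independence
import Summits.Ventures.PercRepro2.Harris
import Summits.Ventures.PercRepro2.Graph
import Summits.Ventures.PercRepro2.Exploration
import Summits.Ventures.PercRepro2.Events
import Summits.Ventures.PercRepro2.FourFunctions
import Summits.Ventures.PercRepro2.Induced
import Summits.Ventures.PercRepro2.Frontier
import Summits.Ventures.PercRepro2.ObsIndependence
import Summits.Ventures.PercRepro2.BHK
import Summits.Ventures.PercRepro2.BHKEvents
import Summits.Ventures.PercRepro2.SideAgreement
import Summits.Ventures.PercRepro2.VdBKahn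
import Summits.Ventures.PercRepro2.BHKAvoid
import Summits.Ventures.PercRepro2.R2PrimeThreeReduction
import Summits.Ventures.PercRepro2.YBridge
import Summits.Ventures.PercRepro2.Yu1Functionals
import Summits.Ventures.PercRepro2.Yu1Events
import Summits.Ventures.PercRepro2.Yu1
import Summits.Ventures.PercRepro2.LBSplit
import Summits.Ventures.PercRepro2.YDelta
import Summits.Ventures.PercRepro2.SD
import Summits.Ventures.PercRepro2.Threshold
import Summits.Ventures.PercRepro2.Lambda
import Summits.Ventures.PercRepro2.LambdaTau
import Summits.Ventures.PercRepro2.LambdaSlack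
import Summits.Ventures.PercRepro2.HF2
import Summits.Ventures.PercRepro2.Yu2
import Summits.Ventures.PercRepro2.N0
import Summits.Ventures.PercRepro2.Y
import Summits.Ventures.PercRepro2.YDeltaTools
import Summits.Ventures.PercRepro2.ZDelta
import Summits.Ventures.PercRepro2.ZExpand
import Summits.Ventures.PercRepro2.ISplit
import Summits.Ventures.PercRepro2.MRl
import Summits.Ventures.PercRepro2.ZOloc
import Summits.Ventures.PercRepro2.SideBridge
import Summits.Ventures.PercRepro2.HCov
import Summits.Ventures.PercRepro2.TriDisagreement

import Summits.Ventures.PercRepro2.HCovFns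

/-!
# (HCOV) as a three-copy cubic form: the bridge to the typed disagreement sums (blind cell
PercRepro2, typer-1; p1 g6 ask 2026-08-23T05:35:24Z, `P1-TWOCOPY.md` §8)

On the functions `f₁ … f₁₂` of `HCovFns.lean` and p1's eight-term kernel

  `K₃ x y z = f₂ x f₁ y f₄ z + f₁ x f₃ y f₅ z − f₂ x f₁ y f₆ z − f₂ x f₇ y f₈ z − f₃ x f₇ y f₉ z + f₂ x f₇ y f₁₀ z − f₂ x f₁ y f₁₁ z + f₁ x f₁₂ y f₃ z`

(`K3`, a `sepKernel` — a finite sum of separable kernels): **`hcov_cubic`**: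
`Gc = triSum p ∅ τ K₃ = Σ_{x,y,z} P(x) P(y) P(z) K₃(x, y, z)` (`triSum_empty_sepKernel`: the cubic
form of a separable kernel is the product of the three expectations, `triple_sum_sep`,
`sum_comm4`).  Hence p1's three-copy reduction (`triSum_nonneg_of_pinned`, `TriDisagreement.lean`)
gives **`HCov_of_pinned`**: if every typed three-copy sum of `K₃` with the free edges pinned is
nonnegative, then (HCOV) — and with `ZDelta_of_HCov` the crux — holds for every admissible weight
vector (the weight-free typed-base form of the hypothesis is p1's `typedCount`).
-/

namespace Summit.Ventures.PercRepro2

open UnionCluster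

namespace CovForm

/-! ## Separable kernels and the cubic form -/

section Sep

variable {E : Type*} [Fintype E] [DecidableEq E] {R : Type*} [Field R]

/-- A finite sum of separable kernels `Σ_i c_i f_i(x) g_i(y) h_i(z)`. -/
def sepKernel {n : ℕ} (c : Fin n → R) (f g h : Fin n → Config E → R) :
    Config E → Config E → Config E → R :=
  fun x y z => ∑ i, c i * (f i x * (g i y * h i z))

/-- The cubic form of a separable kernel is the product of the three expectations. -/
lemma triple_sum_sep (p : E → R) (f g h : Config E → R) :
    (∑ x : Config E, ∑ y : Config E, ∑ z : Config E,
        weight p x * weight p y * weight p z * (f x * (g y * h z))) =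
      expect p f * (expect p g * expect p h) := by
  simp only [expect]
  have h1 : (∑ ω, weight p ω * g ω) * (∑ ω, weight p ω * h ω) =
      ∑ y, ∑ z, (weight p y * g y) * (weight p z * h z) :=
    Finset.sum_mul_sum Finset.univ Finset.univ (fun ω => weight p ω * g ω)
      (fun ω => weight p ω * h ω)
  rw [h1, Finset.sum_mul]
  refine Finset.sum_congr rfl fun x _ => ?_
  rw [Finset.mul_sum]
  refine Finset.sum_congr rfl fun y _ => ?_
  rw [Finset.mul_sum]
  refine Finset.sum_congr rfl fun z _ => ?_
  ring

/-- Moving the innermost sum outermost (three swaps). -/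
lemma sum_comm4 {α β γ δ : Type*} [Fintype α] [Fintype β] [Fintype γ] [Fintype δ]
    (F : α → β → γ → δ → R) :
    (∑ x : α, ∑ y : β, ∑ z : γ, ∑ i : δ, F x y z i) =
      ∑ i : δ, ∑ x : α, ∑ y : β, ∑ z : γ, F x y z i := by
  have h1 : ∀ (x : α) (y : β), (∑ z : γ, ∑ i : δ, F x y z i) = ∑ i : δ, ∑ z : γ, F x y z i :=
    fun x y => Finset.sum_comm
  simp only [h1]
  have h2 : ∀ x : α, (∑ y : β, ∑ i : δ, ∑ z : γ, F x y z i) = ∑ i : δ, ∑ y : β, ∑ z : γ, F x y z i :=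
    fun x => Finset.sum_comm
  simp only [h2]
  exact Finset.sum_comm

/-- **The cubic form of a sum of separable kernels** is the corresponding sum of products of
expectations. -/
theorem triSum_empty_sepKernel (p : E → R) (τ : E → ℕ) {n : ℕ} (c : Fin n → R)
    (f g h : Fin n → Config E → R) :
    triSum p ∅ τ (sepKernel c f g h) =
      ∑ i, c i * (expect p (f i) * (expect p (g i) * expect p (h i))) := by
  rw [triSum_empty]
  unfold sepKernel
  have e : ∀ x y z : Config E, weight p x * weight p y * weight p z *
      (∑ i, c i * (f i x * (g i y * h i z))) =
      ∑ i, c i * (weight p x * weight p y * weight p z * (f i x * (g i y * h i z))) := by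
    intro x y z
    rw [Finset.mul_sum]
    refine Finset.sum_congr rfl fun i _ => ?_
    ring
  simp only [e]
  rw [sum_comm4]
  refine Finset.sum_congr rfl fun i _ => ?_
  simp only [← Finset.mul_sum]
  rw [triple_sum_sep]

end Sep

/-! ## The kernel `K₃` and the bridge -/

section Bridge

variable {V : Type*} {E : Type*} [Fintype E] [DecidableEq E] [DecidableEq V] {R : Type*}
  [Field R] [LinearOrder R] [IsStrictOrderedRing R]

/-- **p1's eight-term kernel `K₃`** (`P1-TWOCOPY.md` §8): `K₃ x y z = f₂ x f₁ y f₄ z + f₁ x f₃ y f₅ z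
− f₂ x f₁ y f₆ z − f₂ x f₇ y f₈ z − f₃ x f₇ y f₉ z + f₂ x f₇ y f₁₀ z − f₂ x f₁ y f₁₁ z + f₁ x f₁₂ y f₃ z`. -/
noncomputable def K3 (ends : E → Sym2 V) (o a₁ a₂ a₃ b : V) :
    Config E → Config E → Config E → R :=
  sepKernel ![1, 1, -1, -1, -1, 1, -1, 1]
    ![iPD ends a₁ a₂ a₃, iQ ends a₁ a₂, iPD ends a₁ a₂ a₃, iPD ends a₁ a₂ a₃, f3 ends o a₁ a₂ a₃,
      iPD ends a₁ a₂ a₃, iPD ends a₁ a₂ a₃, iQ ends a₁ a₂]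
    ![iQ ends a₁ a₂, f3 ends o a₁ a₂ a₃, iQ ends a₁ a₂, f7 ends a₁ a₂ b, f7 ends a₁ a₂ b,
      f7 ends a₁ a₂ b, iQ ends a₁ a₂, f12 ends a₁ a₂ a₃ b]
    ![f4 ends o a₁ a₂ b, f5 ends a₁ a₂ a₃ b, f6 ends o a₁ a₂ a₃ b, f7 ends a₁ a₂ o, f7 ends a₁ a₂ a₃,
      f10 ends o a₁ a₂ a₃, f11 ends o a₁ a₂ a₃ b, f3 ends o a₁ a₂ a₃]

omit [DecidableEq V] in
/-- **`hcov_cubic`**: `Gc = D · P(Q) · G` is the cubic form `Σ_{x,y,z} P(x) P(y) P(z) K₃(x,y,z)`. -/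
theorem hcov_cubic (p : E → R) (ends : E → Sym2 V) (o a₁ a₂ a₃ b : V) (τ : E → ℕ) :
    Gc p ends o a₁ a₂ a₃ b = triSum p ∅ τ (K3 ends o a₁ a₂ a₃ b) := by
  unfold K3
  rw [triSum_empty_sepKernel]
  simp only [Fin.sum_univ_succ, Fin.sum_univ_zero, Matrix.cons_val_zero, Matrix.cons_val_succ,
    add_zero]
  rw [expect_f1, expect_f2, expect_f3, expect_f4, expect_f5, expect_f6, expect_f7, expect_f8,
    expect_f9, expect_f10, expect_f11, expect_f12]
  unfold Gc DEF
  ring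

omit [DecidableEq V] in
/-- **(HCOV) from the typed three-copy bases** (p1's reduction `triSum_nonneg_of_pinned` applied to
`K₃`): if every typed sum of `K₃` with the free edges pinned is nonnegative, then (HCOV) holds for
every admissible weight vector. -/
theorem HCov_of_pinned (ends : E → Sym2 V) (o a₁ a₂ a₃ b : V)
    (hbase : ∀ (q : E → R) (G : Finset E) (σ : E → ℕ), (∀ e, 0 ≤ q e ∧ q e ≤ 1) →
      (∀ e, e ∉ G → q e = 0 ∨ q e = 1) → (∀ e ∈ G, σ e = 1 ∨ σ e = 2) →
      0 ≤ triSum q G σ (K3 ends o a₁ a₂ a₃ b))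
    (p : E → R) (hp : IsProbVec p) : HCov p ends o a₁ a₂ a₃ b := by
  unfold HCov
  rw [hcov_cubic p ends o a₁ a₂ a₃ b (fun _ => 0)]
  exact triSum_nonneg_of_pinned (K3 ends o a₁ a₂ a₃ b) hbase p (fun e => ⟨hp.nonneg e, hp.le_one e⟩)
    ∅ (fun _ => 0) (fun e he => absurd he (Finset.notMem_empty e))

end Bridge

/-! ## The closure form of the chain of record -/

section Closure

variable (R : Type*) [Field R] [LinearOrder R] [IsStrictOrderedRing R]

/-- **`HCov_all → ZDelta_all`**: (HCOV) for every finite graph gives the crux of record for every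
finite graph (`ZDelta_of_HCov` with the closure bookkeeping). -/
theorem ZDelta_all_of_HCov_all (h : HCov_all R) : ZDelta_all R := by
  intro V E _ _ _ _ ends p hp o a₁ a₂ a₃ b h12 h13 h23 ho1 ho2 ho3 hob hb1 hb2 hb3 hord
  exact ZDelta_of_HCov p hp ends hord
    (h V E ends p hp o a₁ a₂ a₃ b h12 h13 h23 ho1 ho2 ho3 hob hb1 hb2 hb3)

end Closure

end CovForm

end Summit.Ventures.PercRepro2
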